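import Literature.RepresentationTheory.CompactGroups.CompactMatrixGroupTangent
import HarnessLib

/-!
# Closure properties of polynomial functions on a real normed space

Companion to `CompactMatrixGroupTangent.lean`, §1, where polynomial functions on a real normed
space `E` are written basis-free as `MvPolynomial.aeval (fun ℓ : E →L[ℝ] ℝ => ⇑ℓ) P` for `P` a
polynomial in the continuous linear functionals. This file records the elementary closure
properties of the class `{F : E → ℝ | ∃ P, F = aeval (fun ℓ => ⇑ℓ) P}` that are needed to
recognise concrete functions as polynomial: constants, continuous linear functionals, sums,
products, finite sums and products, precomposition with continuous linear maps between different
spaces (`exists_aeval_coeFn_comp_clm'`), and — for complex-valued functions whose real and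
imaginary parts are polynomial — products, complex conjugates, finite sums, matrix products,
conjugate transposes and traces (`RePolyIm` bookkeeping, stated without introducing a definition).
As an application, **the Wilson plaquette term `M ↦ Re tr (M_{e₁} M_{e₂} M_{e₃}ᴴ M_{e₄}ᴴ)` on
`(M_N(ℂ))^E` is a polynomial function** (`exists_aeval_coeFn_eq_re_trace_plaquette`), as is any
`A ↦ c - Σᵢ (e A)ᵢ²` for a continuous linear `e` (`exists_aeval_coeFn_eq_const_sub_sum_sq`).

Everything is proved; no definitions, no named facts.

## References

* C. Chevalley, *Theory of Lie Groups I* (1946), Ch. VI §VIII (polynomial functions on a vector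
  space, representative functions). [Chevalley1946]
-/

noncomputable section

open Set MvPolynomial

namespace Literature.RepresentationTheory.CompactGroups

section PolyClosure

variable {E : Type*} [NormedAddCommGroup E] [NormedSpace ℝ E]
variable {F' : Type*} [NormedAddCommGroup F'] [NormedSpace ℝ F']

/-- Constants are polynomial functions. [folklore] -/
theorem exists_aeval_coeFn_eq_const (c : ℝ) :
    ∃ P : MvPolynomial (E →L[ℝ] ℝ) ℝ, ∀ x : E,
      MvPolynomial.aeval (R := ℝ) (fun ℓ : E →L[ℝ] ℝ => (ℓ : E → ℝ)) P x = c :=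
  ⟨MvPolynomial.C c, fun x => by rw [MvPolynomial.algHom_C]; rfl⟩

/-- Continuous linear functionals are polynomial functions. [folklore] -/
theorem exists_aeval_coeFn_eq_clm (ℓ : E →L[ℝ] ℝ) :
    ∃ P : MvPolynomial (E →L[ℝ] ℝ) ℝ, ∀ x : E,
      MvPolynomial.aeval (R := ℝ) (fun ℓ : E →L[ℝ] ℝ => (ℓ : E → ℝ)) P x = ℓ x :=
  ⟨MvPolynomial.X ℓ, fun x => by rw [MvPolynomial.aeval_X]⟩

/-- Sums of polynomial functions are polynomial. [folklore] -/
theorem exists_aeval_coeFn_eq_add {f g : E → ℝ}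
    (hf : ∃ P : MvPolynomial (E →L[ℝ] ℝ) ℝ, ∀ x : E,
      MvPolynomial.aeval (R := ℝ) (fun ℓ : E →L[ℝ] ℝ => (ℓ : E → ℝ)) P x = f x)
    (hg : ∃ P : MvPolynomial (E →L[ℝ] ℝ) ℝ, ∀ x : E,
      MvPolynomial.aeval (R := ℝ) (fun ℓ : E →L[ℝ] ℝ => (ℓ : E → ℝ)) P x = g x) :
    ∃ P : MvPolynomial (E →L[ℝ] ℝ) ℝ, ∀ x : E,
      MvPolynomial.aeval (R := ℝ) (fun ℓ : E →L[ℝ] ℝ => (ℓ : E → ℝ)) P x = f x + g x := by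
  obtain ⟨P, hP⟩ := hf
  obtain ⟨Q, hQ⟩ := hg
  exact ⟨P + Q, fun x => by rw [map_add, Pi.add_apply, hP, hQ]⟩

/-- Products of polynomial functions are polynomial. [folklore] -/
theorem exists_aeval_coeFn_eq_mul {f g : E → ℝ}
    (hf : ∃ P : MvPolynomial (E →L[ℝ] ℝ) ℝ, ∀ x : E,
      MvPolynomial.aeval (R := ℝ) (fun ℓ : E →L[ℝ] ℝ => (ℓ : E → ℝ)) P x = f x)
    (hg : ∃ P : MvPolynomial (E →L[ℝ] ℝ) ℝ, ∀ x : E,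
      MvPolynomial.aeval (R := ℝ) (fun ℓ : E →L[ℝ] ℝ => (ℓ : E → ℝ)) P x = g x) :
    ∃ P : MvPolynomial (E →L[ℝ] ℝ) ℝ, ∀ x : E,
      MvPolynomial.aeval (R := ℝ) (fun ℓ : E →L[ℝ] ℝ => (ℓ : E → ℝ)) P x = f x * g x := by
  obtain ⟨P, hP⟩ := hf
  obtain ⟨Q, hQ⟩ := hg
  exact ⟨P * Q, fun x => by rw [map_mul, Pi.mul_apply, hP, hQ]⟩

/-- Differences of polynomial functions are polynomial. [folklore] -/
theorem exists_aeval_coeFn_eq_sub {f g : E → ℝ}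
    (hf : ∃ P : MvPolynomial (E →L[ℝ] ℝ) ℝ, ∀ x : E,
      MvPolynomial.aeval (R := ℝ) (fun ℓ : E →L[ℝ] ℝ => (ℓ : E → ℝ)) P x = f x)
    (hg : ∃ P : MvPolynomial (E →L[ℝ] ℝ) ℝ, ∀ x : E,
      MvPolynomial.aeval (R := ℝ) (fun ℓ : E →L[ℝ] ℝ => (ℓ : E → ℝ)) P x = g x) :
    ∃ P : MvPolynomial (E →L[ℝ] ℝ) ℝ, ∀ x : E,
      MvPolynomial.aeval (R := ℝ) (fun ℓ : E →L[ℝ] ℝ => (ℓ : E → ℝ)) P x = f x - g x := by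
  obtain ⟨P, hP⟩ := hf
  obtain ⟨Q, hQ⟩ := hg
  exact ⟨P - Q, fun x => by rw [map_sub, Pi.sub_apply, hP, hQ]⟩

/-- Negatives of polynomial functions are polynomial. [folklore] -/
theorem exists_aeval_coeFn_eq_neg {f : E → ℝ}
    (hf : ∃ P : MvPolynomial (E →L[ℝ] ℝ) ℝ, ∀ x : E,
      MvPolynomial.aeval (R := ℝ) (fun ℓ : E →L[ℝ] ℝ => (ℓ : E → ℝ)) P x = f x) :
    ∃ P : MvPolynomial (E →L[ℝ] ℝ) ℝ, ∀ x : E,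
      MvPolynomial.aeval (R := ℝ) (fun ℓ : E →L[ℝ] ℝ => (ℓ : E → ℝ)) P x = -f x := by
  obtain ⟨P, hP⟩ := hf
  exact ⟨-P, fun x => by rw [map_neg, Pi.neg_apply, hP]⟩

/-- Finite sums of polynomial functions are polynomial. [folklore] -/
theorem exists_aeval_coeFn_eq_finset_sum {ι : Type*} (s : Finset ι) {f : ι → E → ℝ}
    (hf : ∀ i ∈ s, ∃ P : MvPolynomial (E →L[ℝ] ℝ) ℝ, ∀ x : E,
      MvPolynomial.aeval (R := ℝ) (fun ℓ : E →L[ℝ] ℝ => (ℓ : E → ℝ)) P x = f i x) :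
    ∃ P : MvPolynomial (E →L[ℝ] ℝ) ℝ, ∀ x : E,
      MvPolynomial.aeval (R := ℝ) (fun ℓ : E →L[ℝ] ℝ => (ℓ : E → ℝ)) P x = ∑ i ∈ s, f i x := by
  classical
  induction s using Finset.induction_on with
  | empty => exact ⟨0, fun x => by simp⟩
  | insert i s hi ih =>
    obtain ⟨P, hP⟩ := hf i (Finset.mem_insert_self i s)
    obtain ⟨Q, hQ⟩ := ih fun j hj => hf j (Finset.mem_insert_of_mem hj)
    refine ⟨P + Q, fun x => ?_⟩
    rw [Finset.sum_insert hi, map_add, Pi.add_apply, hP, hQ]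

/-- Finite products of polynomial functions are polynomial. [folklore] -/
theorem exists_aeval_coeFn_eq_finset_prod {ι : Type*} (s : Finset ι) {f : ι → E → ℝ}
    (hf : ∀ i ∈ s, ∃ P : MvPolynomial (E →L[ℝ] ℝ) ℝ, ∀ x : E,
      MvPolynomial.aeval (R := ℝ) (fun ℓ : E →L[ℝ] ℝ => (ℓ : E → ℝ)) P x = f i x) :
    ∃ P : MvPolynomial (E →L[ℝ] ℝ) ℝ, ∀ x : E,
      MvPolynomial.aeval (R := ℝ) (fun ℓ : E →L[ℝ] ℝ => (ℓ : E → ℝ)) P x = ∏ i ∈ s, f i x := by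
  classical
  induction s using Finset.induction_on with
  | empty => exact ⟨1, fun x => by simp⟩
  | insert i s hi ih =>
    obtain ⟨P, hP⟩ := hf i (Finset.mem_insert_self i s)
    obtain ⟨Q, hQ⟩ := ih fun j hj => hf j (Finset.mem_insert_of_mem hj)
    refine ⟨P * Q, fun x => ?_⟩
    rw [Finset.prod_insert hi, map_mul, Pi.mul_apply, hP, hQ]

/-- **Precomposition with a continuous linear map preserves polynomial functions** (between
possibly different spaces): `P ∘ R` is the polynomial function of `rename (· ∘ R) P`.
[folklore] -/
theorem exists_aeval_coeFn_comp_clm' (P : MvPolynomial (F' →L[ℝ] ℝ) ℝ) (R : E →L[ℝ] F') :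
    ∃ P' : MvPolynomial (E →L[ℝ] ℝ) ℝ, ∀ x : E,
      MvPolynomial.aeval (R := ℝ) (fun ℓ : E →L[ℝ] ℝ => (ℓ : E → ℝ)) P' x =
        MvPolynomial.aeval (R := ℝ) (fun ℓ : F' →L[ℝ] ℝ => (ℓ : F' → ℝ)) P (R x) := by
  refine ⟨MvPolynomial.rename (fun ℓ : F' →L[ℝ] ℝ => ℓ.comp R) P, fun x => ?_⟩
  rw [MvPolynomial.aeval_rename, aeval_pi_apply, aeval_coeFn_apply]
  rfl

/-- A polynomial function on `F'` read through a continuous linear map `E → F'` is a polynomial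
function on `E`. [folklore] -/
theorem exists_aeval_coeFn_eq_comp_clm {f : F' → ℝ}
    (hf : ∃ P : MvPolynomial (F' →L[ℝ] ℝ) ℝ, ∀ y : F',
      MvPolynomial.aeval (R := ℝ) (fun ℓ : F' →L[ℝ] ℝ => (ℓ : F' → ℝ)) P y = f y)
    (R : E →L[ℝ] F') :
    ∃ P : MvPolynomial (E →L[ℝ] ℝ) ℝ, ∀ x : E,
      MvPolynomial.aeval (R := ℝ) (fun ℓ : E →L[ℝ] ℝ => (ℓ : E → ℝ)) P x = f (R x) := by
  obtain ⟨P, hP⟩ := hf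
  obtain ⟨P', hP'⟩ := exists_aeval_coeFn_comp_clm' P R
  exact ⟨P', fun x => by rw [hP', hP]⟩

/-- `A ↦ c - Σᵢ (e A)ᵢ²` is a polynomial function for a continuous linear `e : E → ℝ^ι`.
[folklore] -/
theorem exists_aeval_coeFn_eq_const_sub_sum_sq {ι : Type*} [Fintype ι]
    {V : Type*} [NormedAddCommGroup V] [NormedSpace ℝ V] (e : E →L[ℝ] V) (π : ι → V →L[ℝ] ℝ)
    (c : ℝ) :
    ∃ P : MvPolynomial (E →L[ℝ] ℝ) ℝ, ∀ x : E,
      MvPolynomial.aeval (R := ℝ) (fun ℓ : E →L[ℝ] ℝ => (ℓ : E → ℝ)) P x =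
        c - ∑ i, (π i (e x)) ^ 2 := by
  refine exists_aeval_coeFn_eq_sub (exists_aeval_coeFn_eq_const c)
    (exists_aeval_coeFn_eq_finset_sum _ fun i _ => ?_)
  obtain ⟨P, hP⟩ := exists_aeval_coeFn_eq_mul (exists_aeval_coeFn_eq_clm ((π i).comp e))
    (exists_aeval_coeFn_eq_clm ((π i).comp e))
  exact ⟨P, fun x => by rw [hP, sq]; rfl⟩

/-! ### Complex-valued functions with polynomial real and imaginary parts -/

/-- Products: if `F`, `G : E → ℂ` have polynomial real and imaginary parts, so does `F · G`.
[folklore] -/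
theorem exists_aeval_coeFn_re_im_mul {F G : E → ℂ}
    (hF : (∃ P : MvPolynomial (E →L[ℝ] ℝ) ℝ, ∀ x : E,
        MvPolynomial.aeval (R := ℝ) (fun ℓ : E →L[ℝ] ℝ => (ℓ : E → ℝ)) P x = (F x).re) ∧
      (∃ P : MvPolynomial (E →L[ℝ] ℝ) ℝ, ∀ x : E,
        MvPolynomial.aeval (R := ℝ) (fun ℓ : E →L[ℝ] ℝ => (ℓ : E → ℝ)) P x = (F x).im))
    (hG : (∃ P : MvPolynomial (E →L[ℝ] ℝ) ℝ, ∀ x : E,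
        MvPolynomial.aeval (R := ℝ) (fun ℓ : E →L[ℝ] ℝ => (ℓ : E → ℝ)) P x = (G x).re) ∧
      (∃ P : MvPolynomial (E →L[ℝ] ℝ) ℝ, ∀ x : E,
        MvPolynomial.aeval (R := ℝ) (fun ℓ : E →L[ℝ] ℝ => (ℓ : E → ℝ)) P x = (G x).im)) :
    (∃ P : MvPolynomial (E →L[ℝ] ℝ) ℝ, ∀ x : E,
        MvPolynomial.aeval (R := ℝ) (fun ℓ : E →L[ℝ] ℝ => (ℓ : E → ℝ)) P x = (F x * G x).re) ∧
      (∃ P : MvPolynomial (E →L[ℝ] ℝ) ℝ, ∀ x : E,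
        MvPolynomial.aeval (R := ℝ) (fun ℓ : E →L[ℝ] ℝ => (ℓ : E → ℝ)) P x = (F x * G x).im) := by
  obtain ⟨hFr, hFi⟩ := hF
  obtain ⟨hGr, hGi⟩ := hG
  constructor
  · obtain ⟨P, hP⟩ := exists_aeval_coeFn_eq_sub (exists_aeval_coeFn_eq_mul hFr hGr)
      (exists_aeval_coeFn_eq_mul hFi hGi)
    exact ⟨P, fun x => by rw [hP, Complex.mul_re]⟩
  · obtain ⟨P, hP⟩ := exists_aeval_coeFn_eq_add (exists_aeval_coeFn_eq_mul hFr hGi)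
      (exists_aeval_coeFn_eq_mul hFi hGr)
    exact ⟨P, fun x => by rw [hP, Complex.mul_im]⟩

/-- Conjugates: if `F : E → ℂ` has polynomial real and imaginary parts, so does `conj ∘ F`.
[folklore] -/
theorem exists_aeval_coeFn_re_im_star {F : E → ℂ}
    (hF : (∃ P : MvPolynomial (E →L[ℝ] ℝ) ℝ, ∀ x : E,
        MvPolynomial.aeval (R := ℝ) (fun ℓ : E →L[ℝ] ℝ => (ℓ : E → ℝ)) P x = (F x).re) ∧
      (∃ P : MvPolynomial (E →L[ℝ] ℝ) ℝ, ∀ x : E,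
        MvPolynomial.aeval (R := ℝ) (fun ℓ : E →L[ℝ] ℝ => (ℓ : E → ℝ)) P x = (F x).im)) :
    (∃ P : MvPolynomial (E →L[ℝ] ℝ) ℝ, ∀ x : E,
        MvPolynomial.aeval (R := ℝ) (fun ℓ : E →L[ℝ] ℝ => (ℓ : E → ℝ)) P x = (star (F x)).re) ∧
      (∃ P : MvPolynomial (E →L[ℝ] ℝ) ℝ, ∀ x : E,
        MvPolynomial.aeval (R := ℝ) (fun ℓ : E →L[ℝ] ℝ => (ℓ : E → ℝ)) P x = (star (F x)).im) := by
  obtain ⟨hFr, hFi⟩ := hF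
  constructor
  · obtain ⟨P, hP⟩ := hFr
    exact ⟨P, fun x => by rw [hP, Complex.star_def, Complex.conj_re]⟩
  · obtain ⟨P, hP⟩ := exists_aeval_coeFn_eq_neg hFi
    exact ⟨P, fun x => by rw [hP, Complex.star_def, Complex.conj_im]⟩

/-- Finite sums: if the `F i : E → ℂ` have polynomial real and imaginary parts, so does `Σᵢ F i`.
[folklore] -/
theorem exists_aeval_coeFn_re_im_finset_sum {ι : Type*} (s : Finset ι) {F : ι → E → ℂ}
    (hF : ∀ i ∈ s, (∃ P : MvPolynomial (E →L[ℝ] ℝ) ℝ, ∀ x : E,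
        MvPolynomial.aeval (R := ℝ) (fun ℓ : E →L[ℝ] ℝ => (ℓ : E → ℝ)) P x = (F i x).re) ∧
      (∃ P : MvPolynomial (E →L[ℝ] ℝ) ℝ, ∀ x : E,
        MvPolynomial.aeval (R := ℝ) (fun ℓ : E →L[ℝ] ℝ => (ℓ : E → ℝ)) P x = (F i x).im)) :
    (∃ P : MvPolynomial (E →L[ℝ] ℝ) ℝ, ∀ x : E,
        MvPolynomial.aeval (R := ℝ) (fun ℓ : E →L[ℝ] ℝ => (ℓ : E → ℝ)) P x =
          (∑ i ∈ s, F i x).re) ∧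
      (∃ P : MvPolynomial (E →L[ℝ] ℝ) ℝ, ∀ x : E,
        MvPolynomial.aeval (R := ℝ) (fun ℓ : E →L[ℝ] ℝ => (ℓ : E → ℝ)) P x =
          (∑ i ∈ s, F i x).im) := by
  constructor
  · obtain ⟨P, hP⟩ := exists_aeval_coeFn_eq_finset_sum s fun i hi => (hF i hi).1
    exact ⟨P, fun x => by rw [hP, Complex.re_sum]⟩
  · obtain ⟨P, hP⟩ := exists_aeval_coeFn_eq_finset_sum s fun i hi => (hF i hi).2
    exact ⟨P, fun x => by rw [hP, Complex.im_sum]⟩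

/-! ### Matrix-valued functions with polynomial entries -/

variable {n : Type*} [Fintype n]

/-- Matrix products: if all entries of `X x`, `Y x` have polynomial real and imaginary parts, so
do all entries of `X x * Y x`. [folklore] -/
theorem exists_aeval_coeFn_re_im_matrix_mul {X Y : E → Matrix n n ℂ}
    (hX : ∀ i j, (∃ P : MvPolynomial (E →L[ℝ] ℝ) ℝ, ∀ x : E,
        MvPolynomial.aeval (R := ℝ) (fun ℓ : E →L[ℝ] ℝ => (ℓ : E → ℝ)) P x = (X x i j).re) ∧
      (∃ P : MvPolynomial (E →L[ℝ] ℝ) ℝ, ∀ x : E,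
        MvPolynomial.aeval (R := ℝ) (fun ℓ : E →L[ℝ] ℝ => (ℓ : E → ℝ)) P x = (X x i j).im))
    (hY : ∀ i j, (∃ P : MvPolynomial (E →L[ℝ] ℝ) ℝ, ∀ x : E,
        MvPolynomial.aeval (R := ℝ) (fun ℓ : E →L[ℝ] ℝ => (ℓ : E → ℝ)) P x = (Y x i j).re) ∧
      (∃ P : MvPolynomial (E →L[ℝ] ℝ) ℝ, ∀ x : E,
        MvPolynomial.aeval (R := ℝ) (fun ℓ : E →L[ℝ] ℝ => (ℓ : E → ℝ)) P x = (Y x i j).im)) :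
    ∀ i j, (∃ P : MvPolynomial (E →L[ℝ] ℝ) ℝ, ∀ x : E,
        MvPolynomial.aeval (R := ℝ) (fun ℓ : E →L[ℝ] ℝ => (ℓ : E → ℝ)) P x =
          ((X x * Y x) i j).re) ∧
      (∃ P : MvPolynomial (E →L[ℝ] ℝ) ℝ, ∀ x : E,
        MvPolynomial.aeval (R := ℝ) (fun ℓ : E →L[ℝ] ℝ => (ℓ : E → ℝ)) P x =
          ((X x * Y x) i j).im) := by
  intro i j
  have h := exists_aeval_coeFn_re_im_finset_sum (E := E) Finset.univ
    (F := fun k x => X x i k * Y x k j) fun k _ => exists_aeval_coeFn_re_im_mul (hX i k) (hY k j)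
  simp only [Matrix.mul_apply]
  exact h

omit [Fintype n] in
/-- Conjugate transposes: if all entries of `X x` have polynomial real and imaginary parts, so do
all entries of `(X x)ᴴ`. [folklore] -/
theorem exists_aeval_coeFn_re_im_conjTranspose {X : E → Matrix n n ℂ}
    (hX : ∀ i j, (∃ P : MvPolynomial (E →L[ℝ] ℝ) ℝ, ∀ x : E,
        MvPolynomial.aeval (R := ℝ) (fun ℓ : E →L[ℝ] ℝ => (ℓ : E → ℝ)) P x = (X x i j).re) ∧
      (∃ P : MvPolynomial (E →L[ℝ] ℝ) ℝ, ∀ x : E,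
        MvPolynomial.aeval (R := ℝ) (fun ℓ : E →L[ℝ] ℝ => (ℓ : E → ℝ)) P x = (X x i j).im)) :
    ∀ i j, (∃ P : MvPolynomial (E →L[ℝ] ℝ) ℝ, ∀ x : E,
        MvPolynomial.aeval (R := ℝ) (fun ℓ : E →L[ℝ] ℝ => (ℓ : E → ℝ)) P x =
          ((X x).conjTranspose i j).re) ∧
      (∃ P : MvPolynomial (E →L[ℝ] ℝ) ℝ, ∀ x : E,
        MvPolynomial.aeval (R := ℝ) (fun ℓ : E →L[ℝ] ℝ => (ℓ : E → ℝ)) P x =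
          ((X x).conjTranspose i j).im) := by
  intro i j
  simp only [Matrix.conjTranspose_apply]
  exact exists_aeval_coeFn_re_im_star (hX j i)

/-- Traces: if all entries of `X x` have polynomial real and imaginary parts, then
`x ↦ Re tr (X x)` is a polynomial function. [folklore] -/
theorem exists_aeval_coeFn_eq_re_trace {X : E → Matrix n n ℂ}
    (hX : ∀ i j, (∃ P : MvPolynomial (E →L[ℝ] ℝ) ℝ, ∀ x : E,
        MvPolynomial.aeval (R := ℝ) (fun ℓ : E →L[ℝ] ℝ => (ℓ : E → ℝ)) P x = (X x i j).re) ∧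
      (∃ P : MvPolynomial (E →L[ℝ] ℝ) ℝ, ∀ x : E,
        MvPolynomial.aeval (R := ℝ) (fun ℓ : E →L[ℝ] ℝ => (ℓ : E → ℝ)) P x = (X x i j).im)) :
    ∃ P : MvPolynomial (E →L[ℝ] ℝ) ℝ, ∀ x : E,
      MvPolynomial.aeval (R := ℝ) (fun ℓ : E →L[ℝ] ℝ => (ℓ : E → ℝ)) P x = ((X x).trace).re := by
  have h := exists_aeval_coeFn_re_im_finset_sum (E := E) Finset.univ
    (F := fun i x => X x i i) fun i _ => hX i i
  simp only [Matrix.trace, Matrix.diag_apply]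
  exact h.1

/-- The entries of a complex matrix depending continuously-linearly on the point have polynomial
(indeed linear) real and imaginary parts: case of a continuous linear `L : E → M_n(ℂ)`.
[folklore] -/
theorem exists_aeval_coeFn_re_im_clm_entry (L : E →L[ℝ] Matrix n n ℂ) (i j : n) :
    (∃ P : MvPolynomial (E →L[ℝ] ℝ) ℝ, ∀ x : E,
        MvPolynomial.aeval (R := ℝ) (fun ℓ : E →L[ℝ] ℝ => (ℓ : E → ℝ)) P x = (L x i j).re) ∧
      (∃ P : MvPolynomial (E →L[ℝ] ℝ) ℝ, ∀ x : E,
        MvPolynomial.aeval (R := ℝ) (fun ℓ : E →L[ℝ] ℝ => (ℓ : E → ℝ)) P x = (L x i j).im) := by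
  let ent : Matrix n n ℂ →L[ℝ] ℂ :=
    LinearMap.toContinuousLinearMap ((Matrix.entryLinearMap ℂ ℂ i j).restrictScalars ℝ)
  have hent : ∀ M : Matrix n n ℂ, ent M = M i j := fun M => rfl
  constructor
  · refine ⟨MvPolynomial.X (Complex.reCLM.comp (ent.comp L)), fun x => ?_⟩
    rw [MvPolynomial.aeval_X]
    rfl
  · refine ⟨MvPolynomial.X (Complex.imCLM.comp (ent.comp L)), fun x => ?_⟩
    rw [MvPolynomial.aeval_X]
    rfl

/-- **The Wilson plaquette term is a polynomial function**: for continuous linear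
`L₁, L₂, L₃, L₄ : E → M_n(ℂ)`, `x ↦ Re tr (L₁x · L₂x · (L₃x)ᴴ · (L₄x)ᴴ)` is a polynomial function
on `E`. [folklore] -/
theorem exists_aeval_coeFn_eq_re_trace_plaquette (L₁ L₂ L₃ L₄ : E →L[ℝ] Matrix n n ℂ) :
    ∃ P : MvPolynomial (E →L[ℝ] ℝ) ℝ, ∀ x : E,
      MvPolynomial.aeval (R := ℝ) (fun ℓ : E →L[ℝ] ℝ => (ℓ : E → ℝ)) P x =
        ((L₁ x * L₂ x * (L₃ x).conjTranspose * (L₄ x).conjTranspose).trace).re := by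
  refine exists_aeval_coeFn_eq_re_trace
    (X := fun x => L₁ x * L₂ x * (L₃ x).conjTranspose * (L₄ x).conjTranspose) ?_
  refine exists_aeval_coeFn_re_im_matrix_mul
    (X := fun x => L₁ x * L₂ x * (L₃ x).conjTranspose) (Y := fun x => (L₄ x).conjTranspose) ?_
    (exists_aeval_coeFn_re_im_conjTranspose (exists_aeval_coeFn_re_im_clm_entry L₄))
  refine exists_aeval_coeFn_re_im_matrix_mul
    (X := fun x => L₁ x * L₂ x) (Y := fun x => (L₃ x).conjTranspose) ?_
    (exists_aeval_coeFn_re_im_conjTranspose (exists_aeval_coeFn_re_im_clm_entry L₃))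
  exact exists_aeval_coeFn_re_im_matrix_mul (exists_aeval_coeFn_re_im_clm_entry L₁)
    (exists_aeval_coeFn_re_im_clm_entry L₂)

end PolyClosure

end Literature.RepresentationTheory.CompactGroups

end
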